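import Literature.Computability.Complexity.HypercontractivityPQ
import Literature.Computability.Complexity.FourierDegreeAlgebra
import Literature.Combinatorics.Optimization.LPRelaxationsMaxCSP
import HarnessLib

/-!
# Fawzi 2021, §3: the nonnegative rank of the hypercube kernel `(1-ε)(xᵀy)²/n + ε` is `≥ e^{c√n}`

H. Fawzi, *On polyhedral approximations of the positive semidefinite cone*, Math. Oper. Res. 46
(2021) 1479–1489 = arXiv:1811.09649 [Fawzi2021], §3 "Proof of Theorem 1", paragraphs
*Slack matrix* (eq. (3.3): "we will work with the `2^n × 2^n` matrix
`(x,y) ↦ (1-ε) (1/n) (xᵀy)² + ε` (`x, y ∈ {-1,1}^n`)") and *Nonnegative factorization* (pp. 6–7).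
This file PROVES the heart of Theorem 1 in nonnegative-rank form:

* `Fawzi2021.quadKernel n ε s t = (1-ε) (σ_sᵀ σ_t)²/n + ε` on the cube `{0,1}^n` (signs `σ = sgn`),
  its row means (`sum_quadKernel : E_s K(s,t) = 1`, "`E_x[(1-ε)(1/n)(xᵀy)² + ε] = 1`"), the bound
  `K ≤ n`, and the action of the noise operator in the first variable
  (`noiseOperator_quadKernel_self : (T_ρ K(·,t))(t) = (1-ε)(1 + ρ²(n-1)) + ε`, from
  "`T_ρ q_y(x) = 1 + ρ²(q_y(x) - 1)`" and "`q_y(y) = n`");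
* **`Fawzi2021.quadKernel_nonnegRank`**: for every `0 < ε < 1` there are `c > 0` and `n₀` such that
  for `n ≥ n₀` every nonnegative factorization `K(s,t) = ∑_{l<N} U_s(l) V_l(t)` (the tree's
  `HasNonnegFactorization`) has `e^{c√n} ≤ N`.

THE PRINTED ARGUMENT, followed step by step (pp. 6–7): normalise `E f_i = 1`, `∑_i g_i ≡ 1`; apply
`T_ρ` in `x` and evaluate at `x = y`: `∑_i T_ρ f_i(y) g_i(y) = (1-ε)(1 + ρ²(n-1)) + ε`; split
`I = {i : ‖f_i‖_∞ ≥ e^{√n}}` (then `‖g_i‖_∞ ≤ n e^{-√n}` since `f_i(x) g_i(y) ≤ K ≤ n`); if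
`|I| ≥ e^{√n/4}` there is nothing to show; otherwise on `A = {y : T_ρ f_i(y) ≤ e^{√n/2} ∀ i ∈ I}`
(`μ(A) ≥ 1 - |I| e^{-√n/2}` by Markov and a union bound) the `I`-part of the sum is `≤ 1`, so some
`i ∉ I` has `T_ρ f_i(y) ≥ 4`, and Lemma 1 (`card_noiseOperator_ge_le`, file
`HypercontractivityPQ.lean`) bounds each `μ{T_ρ f_i ≥ 4}`, `i ∉ I`, by `(e/4)^{1+√n/κ}`; hence
`|I^c| ≥ μ(A) (4/e)^{1+√n/κ}` and `N = |I| + |I^c| ≥ e^{C√n}`.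
BOOKKEEPING DEVIATIONS (recorded): the paper fixes `ε = 1/3`, `ρ² = 5/n` and thresholds `4`, `3`
("it is easy to see that the proof works with any constant `0 < ε < 1`"); here, for general `ε`,
`ρ² = κ/n` with `κ = 10/(1-ε)`, so that the diagonal value is `1 + 10(n-1)/n ≥ 6` and a single
threshold `4` serves both cases; the explicit constants are `c = min(1/4, log(4/e)/(2κ))` and
`n₀ = max(6144, ⌈κ²⌉, ⌈(2κ/log(4/e))²⌉)`.

No named facts; definitions: `ip`, `pairCoef`, `pairPart`, `quadKernel` (with unfolding lemmas).
The polytope statement (Theorem 1 itself: density matrices, generalized Yannakakis) is the companion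
file `DensityMatricesPolyhedralApproximation.lean`.
-/

noncomputable section

namespace Literature.Combinatorics.Optimization

namespace Fawzi2021

open Finset Real
open Literature.Probability.RandomGraphs.LowDegree (sgn sgn_mul_self walsh)
open Literature.Computability.Complexity.LowDegree

variable {n : ℕ}

/-! ### Signs, the inner product of sign vectors, the kernel -/

/-- `sgn b ∈ {±1}` squares to one. [folklore] -/
private theorem sgn_sq (b : Bool) : sgn b ^ 2 = 1 := by rw [sq, sgn_mul_self]

/-- `|sgn b| = 1`. [folklore] -/
private theorem abs_sgn (b : Bool) : |sgn b| = 1 := by cases b <;> simp [sgn]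

/-- The inner product of the sign vectors of two cube points: `ip s t = ∑ᵢ σ(sᵢ) σ(tᵢ) = xᵀy` for
`x = σ(s)`, `y = σ(t) ∈ {-1,1}^n`. [cite: Fawzi2021, §3 eq. (3.3) (p. 6)] -/
def ip (s t : Fin n → Bool) : ℝ := ∑ i, sgn (s i) * sgn (t i)

/-- `ip` is symmetric: `xᵀy = yᵀx`. [cite: Fawzi2021, §3 eq. (3.3) (p. 6)] -/
theorem ip_comm (s t : Fin n → Bool) : ip s t = ip t s := by
  unfold ip; exact sum_congr rfl fun i _ => mul_comm _ _

/-- `xᵀx = n`. [cite: Fawzi2021, §3 (p. 6: "using `q_y(y) = n`")] -/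
theorem ip_self (t : Fin n → Bool) : ip t t = n := by
  unfold ip; simp [sgn_mul_self]

/-- `|xᵀy| ≤ n`. [folklore] -/
private theorem abs_ip_le (s t : Fin n → Bool) : |ip s t| ≤ n := by
  unfold ip
  calc |∑ i, sgn (s i) * sgn (t i)| ≤ ∑ i : Fin n, |sgn (s i) * sgn (t i)| := abs_sum_le_sum_abs _ _
    _ = ∑ i : Fin n, (1 : ℝ) := sum_congr rfl fun i _ => by rw [abs_mul, abs_sgn, abs_sgn, mul_one]
    _ = n := by simp

/-- `(xᵀy)² ≤ n²` for `x, y ∈ {-1,1}^n` (so that the kernel is `≤ (1-ε)n + ε ≤ n`).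
[cite: Fawzi2021, §3 (p. 7: "`‖f_i‖_∞ ‖g_i‖_∞ ≤ n`")] -/
theorem ip_sq_le (s t : Fin n → Bool) : ip s t ^ 2 ≤ (n : ℝ) ^ 2 := by
  have h := abs_ip_le s t
  have h0 : 0 ≤ |ip s t| := abs_nonneg _
  calc ip s t ^ 2 = |ip s t| ^ 2 := (sq_abs _).symm
    _ ≤ (n : ℝ) ^ 2 := pow_le_pow_left₀ h0 h 2

/-- **Fawzi's hypercube kernel** (the `2^n × 2^n` submatrix of the slack matrix of the pair
`((1-ε)C, C)`, `C = D - I/n`): `K(s,t) = (1-ε)(xᵀy)²/n + ε`, `x = σ(s)`, `y = σ(t)`.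
[cite: Fawzi2021, §3 eq. (3.3) (p. 6)] -/
def quadKernel (n : ℕ) (ε : ℝ) (s t : Fin n → Bool) : ℝ := (1 - ε) * ip s t ^ 2 / n + ε

/-- Unfolding lemma. [cite: Fawzi2021, §3 eq. (3.3) (p. 6)] -/
theorem quadKernel_apply (ε : ℝ) (s t : Fin n → Bool) :
    quadKernel n ε s t = (1 - ε) * ip s t ^ 2 / n + ε := rfl

/-- `K` is a symmetric matrix. [cite: Fawzi2021, §3 eq. (3.3) (p. 6)] -/
theorem quadKernel_comm (ε : ℝ) (s t : Fin n → Bool) : quadKernel n ε s t = quadKernel n ε t s := by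
  rw [quadKernel_apply, quadKernel_apply, ip_comm]

/-- `0 ≤ K` for `0 ≤ ε ≤ 1` (it is a slack matrix: "`S_{K,L}(x,y) ≥ 0` for all `x,y`").
[cite: Fawzi2021, §2.2 (p. 5) and §3 eq. (3.3) (p. 6)] -/
theorem quadKernel_nonneg {ε : ℝ} (hε0 : 0 ≤ ε) (hε1 : ε ≤ 1) (s t : Fin n → Bool) :
    0 ≤ quadKernel n ε s t := by
  rw [quadKernel_apply]
  have : 0 ≤ (1 - ε) * ip s t ^ 2 / n := by
    apply div_nonneg (mul_nonneg (by linarith) (sq_nonneg _)) (Nat.cast_nonneg _)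
  linarith

/-- `K ≤ n` for `0 ≤ ε ≤ 1` and `n ≥ 1` ("since `f_i, g_i ≥ 0` it must be that
`‖f_i‖_∞ ‖g_i‖_∞ ≤ n`"). [cite: Fawzi2021, §3 (p. 7)] -/
theorem quadKernel_le {ε : ℝ} (hε0 : 0 ≤ ε) (hε1 : ε ≤ 1) (hn : 1 ≤ n) (s t : Fin n → Bool) :
    quadKernel n ε s t ≤ n := by
  rw [quadKernel_apply]
  have hn' : (1 : ℝ) ≤ n := by exact_mod_cast hn
  have hnpos : (0 : ℝ) < n := by linarith
  have h1 : ip s t ^ 2 / n ≤ n := by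
    rw [div_le_iff₀ hnpos, ← sq]
    exact ip_sq_le s t
  have h2 : (1 - ε) * ip s t ^ 2 / n ≤ (1 - ε) * n := by
    rw [mul_div_assoc]
    exact mul_le_mul_of_nonneg_left h1 (by linarith)
  nlinarith

/-! ### The pair expansion `(xᵀy)² = n + ∑_{i≠j} xᵢxⱼyᵢyⱼ` and the noise operator -/

/-- Coefficient of the pair character `χ_{ij}` in `(xᵀy)²` as a function of `x`: `yᵢyⱼ` off the
diagonal, `0` on it. [cite: Fawzi2021, §3 (p. 6: "`T_ρ q_y(x) = 1 + ρ²(q_y(x) - 1)`")] -/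
def pairCoef (t : Fin n → Bool) (i j : Fin n) : ℝ := if i = j then 0 else sgn (t i) * sgn (t j)

/-- The degree-`2` part of `(xᵀy)²` in `x`: `∑_{i≠j} yᵢyⱼ χ_{ij}(x)`. [cite: Fawzi2021, §3 (p. 6)] -/
def pairPart (t s : Fin n → Bool) : ℝ := ∑ i, ∑ j, pairCoef t i j * walsh {i, j} s

/-- The pair character is the product of the two signs. [folklore] -/
private theorem walsh_pair {i j : Fin n} (hij : i ≠ j) (s : Fin n → Bool) :
    walsh ({i, j} : Finset (Fin n)) s = sgn (s i) * sgn (s j) := by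
  unfold walsh
  rw [prod_pair hij]

/-- **`(xᵀy)² = n + ∑_{i≠j} yᵢyⱼ · xᵢxⱼ`** (the squares `xᵢ²yᵢ² = 1` contribute `n`).
[cite: Fawzi2021, §3 (p. 6)] -/
theorem ip_sq_eq (s t : Fin n → Bool) : ip s t ^ 2 = n + pairPart t s := by
  unfold ip pairPart
  rw [sq, sum_mul_sum]
  have key : ∀ i j : Fin n, sgn (s i) * sgn (t i) * (sgn (s j) * sgn (t j)) =
      (if i = j then (1 : ℝ) else 0) + pairCoef t i j * walsh {i, j} s := by
    intro i j
    unfold pairCoef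
    by_cases hij : i = j
    · subst hij
      simp only [if_true, zero_mul, add_zero]
      calc sgn (s i) * sgn (t i) * (sgn (s i) * sgn (t i))
          = (sgn (s i) * sgn (s i)) * (sgn (t i) * sgn (t i)) := by ring
        _ = 1 := by rw [sgn_mul_self, sgn_mul_self, mul_one]
    · rw [if_neg hij, if_neg hij, zero_add, walsh_pair hij]
      ring
  simp_rw [key, sum_add_distrib]
  congr 1
  simp

/-- On the diagonal the pair part is `n(n-1)`: `∑_{i≠j} (yᵢyⱼ)² = n² - n`.
[cite: Fawzi2021, §3 (p. 6: "`q_y(y) = n`")] -/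
theorem pairPart_self (t : Fin n → Bool) : pairPart t t = (n : ℝ) * (n - 1) := by
  unfold pairPart
  have key : ∀ i j : Fin n, pairCoef t i j * walsh {i, j} t = if i = j then (0 : ℝ) else 1 := by
    intro i j
    unfold pairCoef
    by_cases hij : i = j
    · rw [if_pos hij, if_pos hij, zero_mul]
    · rw [if_neg hij, if_neg hij, walsh_pair hij]
      calc sgn (t i) * sgn (t j) * (sgn (t i) * sgn (t j))
          = (sgn (t i) * sgn (t i)) * (sgn (t j) * sgn (t j)) := by ring
        _ = 1 := by rw [sgn_mul_self, sgn_mul_self, mul_one]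
  simp_rw [key]
  have row : ∀ i : Fin n, ∑ j : Fin n, (if i = j then (0 : ℝ) else 1) = n - 1 := by
    intro i
    have h1 : ∑ j : Fin n, (if i = j then (0 : ℝ) else 1) =
        ∑ j : Fin n, ((1 : ℝ) - if i = j then 1 else 0) := sum_congr rfl fun j _ => by
      split_ifs <;> simp
    rw [h1, sum_sub_distrib]
    simp
  simp_rw [row]
  simp only [sum_const, card_univ, Fintype.card_fin, nsmul_eq_mul]

/-- The noise operator commutes with finite sums. [cite: ODonnell2014, §2.4] -/
theorem noiseOperator_finset_sum {ι : Type*} (ρ : ℝ) (S : Finset ι) (g : ι → (Fin n → Bool) → ℝ)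
    (y : Fin n → Bool) :
    noiseOperator ρ (fun x => ∑ k ∈ S, g k x) y = ∑ k ∈ S, noiseOperator ρ (g k) y := by
  unfold noiseOperator
  rw [← sum_div]
  congr 1
  rw [sum_comm]
  refine sum_congr rfl fun x _ => ?_
  rw [sum_mul]

/-- **Characters are eigenfunctions of the noise operator**: `T_ρ χ_S = ρ^{|S|} χ_S`.
[cite: ODonnell2014, Prop. 2.47] -/
theorem noiseOperator_walsh (ρ : ℝ) (S : Finset (Fin n)) (y : Fin n → Bool) :
    noiseOperator ρ (walsh S) y = ρ ^ S.card * walsh S y := by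
  rw [noiseOperator_eq_sum_walsh]
  simp_rw [cubeFourierCoeff_walsh]
  simp

/-- **`T_ρ` acts on the pair part by `ρ²`** (every term is a character of degree exactly `2`).
[cite: Fawzi2021, §3 (p. 6: "`T_ρ q_y(x) = 1 + ρ²(q_y(x) - 1)`")] -/
theorem noiseOperator_pairPart (ρ : ℝ) (t y : Fin n → Bool) :
    noiseOperator ρ (pairPart t) y = ρ ^ 2 * pairPart t y := by
  unfold pairPart
  rw [noiseOperator_finset_sum, mul_sum]
  refine sum_congr rfl fun i _ => ?_
  rw [noiseOperator_finset_sum, mul_sum]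
  refine sum_congr rfl fun j _ => ?_
  rw [noiseOperator_smul]
  simp only
  rw [noiseOperator_walsh]
  unfold pairCoef
  by_cases hij : i = j
  · rw [if_pos hij]; ring
  · rw [if_neg hij, card_pair hij]; ring

/-- **The noise operator applied to a row of the kernel, evaluated on the diagonal**:
`(T_ρ K(·,t))(t) = (1-ε)(1 + ρ²(n-1)) + ε` (`n ≥ 1`).
[cite: Fawzi2021, §3 (p. 6: "`(1-ε)(1 + ρ²(n-1)) + ε = ∑_i T_ρ f_i(y) g_i(y)`")] -/
theorem noiseOperator_quadKernel_self {ε ρ : ℝ} (hn : 1 ≤ n) (t : Fin n → Bool) :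
    noiseOperator ρ (fun s => quadKernel n ε s t) t = (1 - ε) * (1 + ρ ^ 2 * (n - 1)) + ε := by
  have hn0 : (n : ℝ) ≠ 0 := by
    have : (1 : ℝ) ≤ n := by exact_mod_cast hn
    linarith
  have hfun : (fun s => quadKernel n ε s t) =
      fun s => (1 - ε) / n * (fun s => (n : ℝ) + pairPart t s) s + ε := by
    funext s
    rw [quadKernel_apply, ip_sq_eq]
    ring
  rw [hfun]
  rw [show (fun s => (1 - ε) / n * (fun s => (n : ℝ) + pairPart t s) s + ε) =
      fun s => (fun s => (1 - ε) / n * (fun s => (n : ℝ) + pairPart t s) s) s + (fun _ => ε) s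
    from rfl]
  rw [noiseOperator_add, noiseOperator_smul, noiseOperator_const]
  simp only
  rw [show (fun s => (n : ℝ) + pairPart t s) = fun s => (fun _ => (n : ℝ)) s + pairPart t s from rfl,
    noiseOperator_add, noiseOperator_const]
  simp only
  rw [noiseOperator_pairPart, pairPart_self]
  field_simp

/-! ### Row means of the kernel -/

/-- `∑_s σ(sᵢ)σ(sⱼ) = 2^n [i = j]` (orthogonality of the degree-`≤ 1` characters). [cite: ODonnell2014, §1.4] -/
theorem sum_sgn_mul_sgn (i j : Fin n) :
    ∑ s : Fin n → Bool, sgn (s i) * sgn (s j) = if i = j then (2 : ℝ) ^ n else 0 := by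
  have h := Literature.Computability.Complexity.LowDegree.sum_walsh_mul_walsh_index
    ({i} : Finset (Fin n)) {j}
  have e : ∀ s : Fin n → Bool, walsh ({i} : Finset (Fin n)) s * walsh {j} s = sgn (s i) * sgn (s j) := by
    intro s; unfold walsh; simp
  simp_rw [e] at h
  rw [h]
  simp only [Finset.singleton_inj]

/-- **`E_x (xᵀy)² = n`**: `∑_s (σ_sᵀσ_t)² = n · 2^n`. [cite: Fawzi2021, §3 (p. 6: "`E_{x}[(1-ε)(1/n)(xᵀy)² + ε] = 1`")] -/
theorem sum_ip_sq (t : Fin n → Bool) : ∑ s : Fin n → Bool, ip s t ^ 2 = (n : ℝ) * 2 ^ n := by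
  unfold ip
  have e1 : ∀ s : Fin n → Bool, (∑ i, sgn (s i) * sgn (t i)) ^ 2 =
      ∑ i, ∑ j, sgn (t i) * sgn (t j) * (sgn (s i) * sgn (s j)) := by
    intro s
    rw [sq, sum_mul_sum]
    exact sum_congr rfl fun i _ => sum_congr rfl fun j _ => by ring
  simp_rw [e1]
  rw [sum_comm]
  simp_rw [sum_comm (s := (univ : Finset (Fin n → Bool))), ← mul_sum, sum_sgn_mul_sgn, mul_ite,
    mul_zero]
  simp [sgn_mul_self]

/-- **Every row of the kernel has mean one**: `∑_s K(s,t) = 2^n` (`n ≥ 1`).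
[cite: Fawzi2021, §3 (p. 6)] -/
theorem sum_quadKernel (ε : ℝ) (hn : 1 ≤ n) (t : Fin n → Bool) :
    ∑ s : Fin n → Bool, quadKernel n ε s t = 2 ^ n := by
  have hn0 : (n : ℝ) ≠ 0 := by
    have : (1 : ℝ) ≤ n := by exact_mod_cast hn
    linarith
  simp_rw [quadKernel_apply]
  rw [sum_add_distrib, sum_const, card_univ, Fintype.card_fun, Fintype.card_bool, Fintype.card_fin,
    nsmul_eq_mul]
  simp_rw [mul_div_assoc, ← mul_sum, ← sum_div]
  rw [sum_ip_sq]
  field_simp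
  push_cast
  ring

/-! ### Markov's inequality and the normalisation of a nonnegative factorization -/

/-- Markov's inequality in counting form on a finite type: for `h ≥ 0` and a threshold `a`,
`#{t : a ≤ h t} · a ≤ ∑_t h t`. [folklore] -/
private theorem card_filter_mul_le_sum {α : Type*} [Fintype α] (h : α → ℝ) (hh : ∀ t, 0 ≤ h t) (a : ℝ) :
    ((univ.filter fun t => a ≤ h t).card : ℝ) * a ≤ ∑ t, h t := by
  calc ((univ.filter fun t => a ≤ h t).card : ℝ) * a = ∑ t ∈ univ.filter (fun t => a ≤ h t), a := by
        rw [sum_const, nsmul_eq_mul]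
    _ ≤ ∑ t ∈ univ.filter (fun t => a ≤ h t), h t := sum_le_sum fun t ht => (mem_filter.1 ht).2
    _ ≤ ∑ t, h t := sum_le_sum_of_subset_of_nonneg (filter_subset _ _) fun t _ _ => hh t

/-- **Normalisation of a nonnegative factorization** ("we can scale the `f_i` so that `E[f_i] = 1` for
all `i`"): from `K(s,t) = ∑_l U_s(l) V_l(t)` with `U, V ≥ 0` one passes to `F_l = U(·,l)/E U(·,l)`
(or `F_l = 1` when `U(·,l) ≡ 0`) and `G_l = E U(·,l) · V_l`, with `F, G ≥ 0`, `E F_l = 1` and the same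
product sum. [cite: Fawzi2021, §3 (p. 6: "we can scale the `f_i` so that `E[f_i] = 1`")] -/
theorem exists_normalized {N : ℕ} {K : (Fin n → Bool) → (Fin n → Bool) → ℝ}
    (hK : HasNonnegFactorization K N) :
    ∃ (F G : Fin N → (Fin n → Bool) → ℝ), (∀ l s, 0 ≤ F l s) ∧ (∀ l t, 0 ≤ G l t) ∧
      (∀ l, (∑ s, F l s) / 2 ^ n = 1) ∧ ∀ s t, K s t = ∑ l, F l s * G l t := by
  obtain ⟨U, V, hU, hV, hUV⟩ := hK
  have h2n : (0 : ℝ) < 2 ^ n := by positivity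
  set a : Fin N → ℝ := fun l => (∑ s, U s l) / 2 ^ n with ha
  have ha0 : ∀ l, 0 ≤ a l := fun l => div_nonneg (sum_nonneg fun s _ => hU s l) h2n.le
  have hzero : ∀ l, a l = 0 → ∀ s, U s l = 0 := by
    intro l hl s
    have hsum : ∑ s, U s l = 0 := by
      rw [ha] at hl
      simpa [h2n.ne'] using hl
    exact (sum_eq_zero_iff_of_nonneg fun s _ => hU s l).1 hsum s (mem_univ s)
  refine ⟨fun l s => if a l = 0 then 1 else U s l / a l, fun l t => a l * V l t, ?_, ?_, ?_, ?_⟩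
  · intro l s
    simp only
    split_ifs with h
    · exact zero_le_one
    · exact div_nonneg (hU s l) (ha0 l)
  · exact fun l t => mul_nonneg (ha0 l) (hV l t)
  · intro l
    simp only
    split_ifs with h
    · simp
    · rw [← sum_div, div_div, mul_comm, ← div_div]
      exact div_self h
  · intro s t
    rw [hUV s t]
    refine sum_congr rfl fun l _ => ?_
    simp only
    split_ifs with h
    · rw [hzero l h s, h]; ring
    · field_simp

/-! ### The main estimate -/

/-- `n ≤ e^{√n/4}` once `n ≥ 6144` (from `x⁴/4! ≤ eˣ` at `x = √n/4`). [folklore] -/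
private theorem nat_le_exp_sqrt_div_four (hn : 6144 ≤ n) : (n : ℝ) ≤ Real.exp (Real.sqrt n / 4) := by
  have hn' : (6144 : ℝ) ≤ n := by exact_mod_cast hn
  have hsq : Real.sqrt (n : ℝ) ^ 2 = n := Real.sq_sqrt (Nat.cast_nonneg n)
  have h4 : (Real.sqrt n / 4) ^ 4 / (Nat.factorial 4) ≤ Real.exp (Real.sqrt n / 4) :=
    Real.pow_div_factorial_le_exp (x := Real.sqrt n / 4) (hx := by positivity) (n := 4)
  have hfac : (Nat.factorial 4 : ℝ) = 24 := by norm_num [Nat.factorial]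
  rw [hfac] at h4
  have e : (Real.sqrt n / 4) ^ 4 / 24 = (n : ℝ) ^ 2 / 6144 := by
    rw [div_pow, show (Real.sqrt (n : ℝ)) ^ 4 = (Real.sqrt n ^ 2) ^ 2 by ring, hsq]
    ring
  rw [e] at h4
  have h5 : (n : ℝ) ≤ (n : ℝ) ^ 2 / 6144 := by
    rw [le_div_iff₀ (by norm_num : (0 : ℝ) < 6144), sq]
    exact mul_le_mul_of_nonneg_left hn' (by linarith)
  exact h5.trans h4

/-- **Fawzi 2021, §3 — the nonnegative rank of the hypercube kernel is weakly exponential.**  For every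
`0 < ε < 1` there are `c > 0` and `n₀` such that for all `n ≥ n₀`: if the `2^n × 2^n` matrix
`K(s,t) = (1-ε)(xᵀy)²/n + ε` (`x, y ∈ {-1,1}^n`) is a sum of `N` nonnegative rank-one matrices
(`HasNonnegFactorization (quadKernel n ε) N`), then `e^{c√n} ≤ N` ("this shows that we must have
`|I| + |I^c| ≥ e^{C√n}` where `C > 0` is an absolute positive constant").  Proof as printed (see the
module docstring), with `ρ² = κ/n`, `κ = 10/(1-ε)`, `c = min(1/4, log(4/e)/(2κ))`.
[cite: Fawzi2021, §3 (pp. 6–7), proof of Thm. 1] -/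
theorem quadKernel_nonnegRank {ε : ℝ} (hε0 : 0 < ε) (hε1 : ε < 1) :
    ∃ c : ℝ, 0 < c ∧ ∃ n₀ : ℕ, ∀ n : ℕ, n₀ ≤ n → ∀ N : ℕ,
      HasNonnegFactorization (quadKernel n ε) N → Real.exp (c * Real.sqrt n) ≤ N := by
  -- constants
  set κ : ℝ := 10 / (1 - ε) with hκ
  have h1ε : 0 < 1 - ε := by linarith
  have hκ10 : 10 ≤ κ := by
    rw [hκ, le_div_iff₀ h1ε]; nlinarith
  have hκpos : 0 < κ := by linarith
  have he : Real.exp 1 < 4 := lt_trans Real.exp_one_lt_d9 (by norm_num)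
  have h4e : 1 < 4 / Real.exp 1 := by rw [lt_div_iff₀ (Real.exp_pos 1)]; linarith
  set c₁ : ℝ := Real.log (4 / Real.exp 1) / κ with hc₁
  have hlog4e : 0 < Real.log (4 / Real.exp 1) := Real.log_pos h4e
  have hc₁pos : 0 < c₁ := div_pos hlog4e hκpos
  set c : ℝ := min (1 / 4) (c₁ / 2) with hc
  have hcpos : 0 < c := lt_min (by norm_num) (by linarith)
  have hc4 : c ≤ 1 / 4 := min_le_left _ _
  have hcc₁ : c ≤ c₁ / 2 := min_le_right _ _
  refine ⟨c, hcpos, max 6144 (max ⌈κ ^ 2⌉₊ ⌈(2 / c₁) ^ 2⌉₊), fun n hn N hfac => ?_⟩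
  -- unpacking `n ≥ n₀`
  have hn6144 : 6144 ≤ n := le_trans (le_max_left _ _) hn
  have hn1 : 1 ≤ n := le_trans (by norm_num) hn6144
  have hnR : (1 : ℝ) ≤ n := by exact_mod_cast hn1
  have hnpos : (0 : ℝ) < n := by linarith
  have hnκ : κ ^ 2 ≤ n := (Nat.le_ceil _).trans (by exact_mod_cast (le_max_left _ _).trans ((le_max_right _ _).trans hn))
  have hnc₁ : (2 / c₁) ^ 2 ≤ n := (Nat.le_ceil _).trans (by exact_mod_cast (le_max_right _ _).trans ((le_max_right _ _).trans hn))
  set r : ℝ := Real.sqrt n with hr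
  have hr0 : 0 < r := Real.sqrt_pos.2 hnpos
  have hrsq : r ^ 2 = n := Real.sq_sqrt hnpos.le
  have hrr : r * r = n := by rw [← sq, hrsq]
  have hκr : κ ≤ r := by
    rw [hr, ← Real.sqrt_sq hκpos.le]
    exact Real.sqrt_le_sqrt hnκ
  have hc₁r : 2 / c₁ ≤ r := by
    rw [hr, ← Real.sqrt_sq (div_pos two_pos hc₁pos).le]
    exact Real.sqrt_le_sqrt hnc₁
  have hr1 : 1 ≤ r := le_trans (by linarith) hκr
  -- `M = e^{√n}`, `ρ² = κ/n`, `q = 1 + √n/κ`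
  set M : ℝ := Real.exp r with hM
  have hMpos : 0 < M := Real.exp_pos r
  have hlogM : Real.log M = r := Real.log_exp r
  set ρ : ℝ := Real.sqrt (κ / n) with hρ
  have hρpos : 0 < ρ := Real.sqrt_pos.2 (div_pos hκpos hnpos)
  have hρsq : ρ ^ 2 = κ / n := Real.sq_sqrt (div_pos hκpos hnpos).le
  have hκsq : κ ≤ κ ^ 2 := by
    rw [sq]; exact le_mul_of_one_le_right hκpos.le (by linarith)
  have hκn : κ ≤ n := hκsq.trans hnκ
  have hρ1 : ρ ≤ 1 := by
    rw [hρ, Real.sqrt_le_one]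
    exact (div_le_one hnpos).2 hκn
  have hq_eq : 1 + (1 / Real.log M) / ρ ^ 2 = 1 + r / κ := by
    rw [hlogM, hρsq, ← hrr]
    field_simp
  have hq2 : 2 ≤ 1 + (1 / Real.log M) / ρ ^ 2 := by
    rw [hq_eq]
    have : 1 ≤ r / κ := by rw [le_div_iff₀ hκpos, one_mul]; exact hκr
    linarith
  -- normalise the factorization
  obtain ⟨F, G, hF0, hG0, hFmean, hFG⟩ := exists_normalized hfac
  have h2n : (0 : ℝ) < 2 ^ n := by positivity
  -- `∑_l G_l(t) = 1`
  have hGsum : ∀ t, ∑ l, G l t = 1 := by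
    intro t
    have h1 : ∑ s, quadKernel n ε s t = ∑ l, (∑ s, F l s) * G l t := by
      simp_rw [hFG, sum_mul]
      rw [sum_comm]
    rw [sum_quadKernel ε hn1 t] at h1
    have h2 : ∑ l, (∑ s, F l s) * G l t = 2 ^ n * ∑ l, G l t := by
      rw [mul_sum]
      refine sum_congr rfl fun l _ => ?_
      have := hFmean l
      rw [div_eq_iff h2n.ne'] at this
      rw [this]; ring
    rw [h2] at h1
    have := mul_left_cancel₀ h2n.ne' (h1.symm.trans (mul_one _).symm)
    exact this
  -- `F_l(s) G_l(t) ≤ K(s,t) ≤ n`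
  have hFGle : ∀ l s t, F l s * G l t ≤ n := by
    intro l s t
    calc F l s * G l t ≤ ∑ l', F l' s * G l' t :=
          single_le_sum (f := fun l' => F l' s * G l' t) (fun l' _ => mul_nonneg (hF0 l' s) (hG0 l' t))
            (mem_univ l)
      _ = quadKernel n ε s t := (hFG s t).symm
      _ ≤ n := quadKernel_le hε0.le hε1.le hn1 s t
  -- Step 1: apply `T_ρ` in `s` and evaluate on the diagonal
  set L : ℝ := (1 - ε) * (1 + ρ ^ 2 * (n - 1)) + ε with hL
  have hL6 : 6 ≤ L := by
    have hn2 : (2 : ℝ) ≤ n := by exact_mod_cast le_trans (by norm_num) hn6144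
    have e1 : (1 - ε) * (ρ ^ 2 * (n - 1)) = 10 * (n - 1) / n := by
      rw [hρsq, hκ]; field_simp
    have e2 : (5 : ℝ) ≤ 10 * (n - 1) / n := by
      rw [le_div_iff₀ hnpos]; linarith
    have : L = 1 + (1 - ε) * (ρ ^ 2 * (n - 1)) := by rw [hL]; ring
    rw [this, e1]; linarith
  have hdiag : ∀ t, ∑ l, G l t * noiseOperator ρ (F l) t = L := by
    intro t
    have hfun : (fun s => quadKernel n ε s t) = fun s => ∑ l, G l t * F l s := by
      funext s; rw [hFG s t]; exact sum_congr rfl fun l _ => mul_comm _ _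
    have h1 := noiseOperator_quadKernel_self (ε := ε) (ρ := ρ) hn1 t
    rw [hfun, noiseOperator_finset_sum] at h1
    rw [← hL] at h1
    rw [← h1]
    refine sum_congr rfl fun l _ => ?_
    rw [noiseOperator_smul]
  -- the index set `I` of spiked functions and its complement
  set I : Finset (Fin N) := univ.filter fun l => ∃ s, M ≤ F l s with hI
  set Ic : Finset (Fin N) := univ.filter fun l => ¬ ∃ s, M ≤ F l s with hIc
  have hGsmall : ∀ l ∈ I, ∀ t, G l t ≤ n / M := by
    intro l hl t
    obtain ⟨s, hs⟩ := (mem_filter.1 hl).2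
    rw [le_div_iff₀ hMpos]
    calc G l t * M ≤ G l t * F l s := mul_le_mul_of_nonneg_left hs (hG0 l t)
      _ = F l s * G l t := mul_comm _ _
      _ ≤ n := hFGle l s t
  have hFflat : ∀ l ∈ Ic, ∀ s, F l s ≤ M := by
    intro l hl s
    have h := (mem_filter.1 hl).2
    by_contra h'
    exact h ⟨s, (not_le.1 h').le⟩
  have hTF0 : ∀ l t, 0 ≤ noiseOperator ρ (F l) t := fun l t => noiseOperator_nonneg hρpos.le hρ1 (hF0 l) t
  have hTFsum : ∀ l, ∑ t, noiseOperator ρ (F l) t = 2 ^ n := by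
    intro l
    rw [sum_noiseOperator]
    have := hFmean l
    rwa [div_eq_iff h2n.ne', one_mul] at this
  have hNcard : ∀ S : Finset (Fin N), (S.card : ℝ) ≤ N := fun S => by
    exact_mod_cast (card_le_univ S).trans_eq (Fintype.card_fin N)
  -- final target: `e^{c√n} ≤ N`; two cases on `|I|`
  by_cases hIbig : Real.exp (r / 4) ≤ I.card
  · -- Case `|I| ≥ e^{√n/4}`
    have hcr : c * r ≤ r / 4 := (mul_le_mul_of_nonneg_right hc4 hr0.le).trans_eq (by ring)
    calc Real.exp (c * r) ≤ Real.exp (r / 4) := Real.exp_le_exp.2 hcr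
      _ ≤ I.card := hIbig
      _ ≤ N := hNcard I
  · push Not at hIbig
    -- Markov: `#{t : T_ρ F_l(t) > e^{√n/2}} ≤ 2^n e^{-√n/2}`
    set B : Fin N → Finset (Fin n → Bool) :=
      fun l => univ.filter fun t => Real.exp (r / 2) ≤ noiseOperator ρ (F l) t with hB
    have hBcard : ∀ l, ((B l).card : ℝ) ≤ 2 ^ n / Real.exp (r / 2) := by
      intro l
      rw [le_div_iff₀ (Real.exp_pos _)]
      have := card_filter_mul_le_sum (noiseOperator ρ (F l)) (hTF0 l) (Real.exp (r / 2))
      rw [hTFsum l] at this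
      exact this
    -- the good set `A` and its complement
    set A : Finset (Fin n → Bool) :=
      univ.filter fun t => ∀ l ∈ I, noiseOperator ρ (F l) t < Real.exp (r / 2) with hA
    set Ac : Finset (Fin n → Bool) :=
      univ.filter fun t => ¬ ∀ l ∈ I, noiseOperator ρ (F l) t < Real.exp (r / 2) with hAc
    have hAAc : (A.card : ℝ) + Ac.card = 2 ^ n := by
      have h := card_filter_add_card_filter_not
        (s := (univ : Finset (Fin n → Bool))) (fun t => ∀ l ∈ I, noiseOperator ρ (F l) t < Real.exp (r / 2))
      rw [card_univ, Fintype.card_fun, Fintype.card_bool, Fintype.card_fin] at h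
      exact_mod_cast h
    have hAc_sub : Ac ⊆ I.biUnion B := by
      intro t ht
      rw [hAc, mem_filter] at ht
      obtain ⟨l, hlI, hl⟩ : ∃ l ∈ I, ¬ noiseOperator ρ (F l) t < Real.exp (r / 2) := by
        by_contra h
        push Not at h
        exact ht.2 fun l hl => h l hl
      exact mem_biUnion.2 ⟨l, hlI, mem_filter.2 ⟨mem_univ t, not_lt.1 hl⟩⟩
    have hAc_card : (Ac.card : ℝ) ≤ I.card * (2 ^ n / Real.exp (r / 2)) := by
      calc (Ac.card : ℝ) ≤ (I.biUnion B).card := by exact_mod_cast card_le_card hAc_sub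
        _ ≤ ∑ l ∈ I, ((B l).card : ℝ) := by exact_mod_cast card_biUnion_le
        _ ≤ ∑ l ∈ I, 2 ^ n / Real.exp (r / 2) := sum_le_sum fun l _ => hBcard l
        _ = I.card * (2 ^ n / Real.exp (r / 2)) := by rw [sum_const, nsmul_eq_mul]
    -- `|Aᶜ| ≤ 2^n e^{-√n/4} ≤ 2^n / 2`
    have hexp_split : Real.exp (r / 2) = Real.exp (r / 4) * Real.exp (r / 4) := by
      rw [← Real.exp_add]; congr 1; ring
    have hexp4 : 2 ≤ Real.exp (r / 4) := by
      have h1 : (2 : ℝ) ≤ r / 4 + 1 := by linarith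
      exact h1.trans (Real.add_one_le_exp _)
    have hAc_half : (Ac.card : ℝ) ≤ 2 ^ n / 2 := by
      have h1 : (I.card : ℝ) * (2 ^ n / Real.exp (r / 2)) ≤ Real.exp (r / 4) * (2 ^ n / Real.exp (r / 2)) :=
        mul_le_mul_of_nonneg_right hIbig.le (by positivity)
      have h2 : Real.exp (r / 4) * (2 ^ n / Real.exp (r / 2)) = 2 ^ n / Real.exp (r / 4) := by
        rw [hexp_split]; field_simp
      have h3 : (2 : ℝ) ^ n / Real.exp (r / 4) ≤ 2 ^ n / 2 :=
        div_le_div_of_nonneg_left h2n.le two_pos hexp4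
      linarith [hAc_card]
    have hA_half : (2 : ℝ) ^ n / 2 ≤ A.card := by linarith
    -- on `A`, some `l ∉ I` has `T_ρ F_l(t) ≥ 4`
    set S : Fin N → Finset (Fin n → Bool) :=
      fun l => univ.filter fun t => (4 : ℝ) ≤ noiseOperator ρ (F l) t with hS
    have hnexp : (n : ℝ) ≤ Real.exp (r / 4) := nat_le_exp_sqrt_div_four hn6144
    have hA_sub : A ⊆ Ic.biUnion S := by
      intro t ht
      rw [hA, mem_filter] at ht
      -- the `I`-part of the diagonal sum is `≤ 1`
      have hIpart : ∑ l ∈ I, G l t * noiseOperator ρ (F l) t ≤ 1 := by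
        calc ∑ l ∈ I, G l t * noiseOperator ρ (F l) t
            ≤ ∑ l ∈ I, n / M * Real.exp (r / 2) := sum_le_sum fun l hl =>
              mul_le_mul (hGsmall l hl t) (ht.2 l hl).le (hTF0 l t) (by positivity)
          _ = I.card * (n / M * Real.exp (r / 2)) := by rw [sum_const, nsmul_eq_mul]
          _ ≤ Real.exp (r / 4) * (n / M * Real.exp (r / 2)) :=
              mul_le_mul_of_nonneg_right hIbig.le (by positivity)
          _ = n / Real.exp (r / 4) := by
              rw [hM, hexp_split, show Real.exp r = Real.exp (r / 4) * Real.exp (r / 4) *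
                (Real.exp (r / 4) * Real.exp (r / 4)) by rw [← Real.exp_add, ← Real.exp_add]; congr 1; ring]
              field_simp
          _ ≤ 1 := by rw [div_le_one (Real.exp_pos _)]; exact hnexp
      -- hence the `I^c`-part is `≥ 5`
      have hsplit : ∑ l ∈ I, G l t * noiseOperator ρ (F l) t + ∑ l ∈ Ic, G l t * noiseOperator ρ (F l) t = L := by
        rw [hI, hIc, sum_filter_add_sum_filter_not]
        exact hdiag t
      have hIcpart : 5 ≤ ∑ l ∈ Ic, G l t * noiseOperator ρ (F l) t := by linarith
      -- if every `l ∉ I` had `T_ρ F_l(t) < 4` the `I^c`-part would be `≤ 4 ∑ G ≤ 4`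
      by_contra hnot
      have hall : ∀ l ∈ Ic, noiseOperator ρ (F l) t < 4 := by
        intro l hl
        by_contra h
        exact hnot (mem_biUnion.2 ⟨l, hl, mem_filter.2 ⟨mem_univ t, not_lt.1 h⟩⟩)
      have h1 : ∑ l ∈ Ic, G l t * noiseOperator ρ (F l) t ≤ ∑ l ∈ Ic, G l t * 4 :=
        sum_le_sum fun l hl => mul_le_mul_of_nonneg_left (hall l hl).le (hG0 l t)
      have h2 : ∑ l ∈ Ic, G l t * 4 ≤ 4 := by
        calc ∑ l ∈ Ic, G l t * 4 ≤ ∑ l, G l t * 4 :=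
              sum_le_sum_of_subset_of_nonneg (filter_subset _ _) fun l _ _ => mul_nonneg (hG0 l t) (by norm_num)
          _ = 4 := by rw [← sum_mul, hGsum t, one_mul]
      linarith
    -- Lemma 1 for the flat functions `l ∉ I`
    have hScard : ∀ l ∈ Ic, ((S l).card : ℝ) ≤ 2 ^ n * (Real.exp 1 / 4) ^ (1 + (1 / Real.log M) / ρ ^ 2) := by
      intro l hl
      exact card_noiseOperator_ge_le (by rw [hlogM]; exact hr1) hρpos hq2 (by norm_num) (hF0 l)
        (hFflat l hl) (hFmean l)
    -- `(e/4)^q ≤ e^{-c₁ √n}`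
    have hbase0 : 0 < Real.exp 1 / 4 := by positivity
    have hbase1 : Real.exp 1 / 4 ≤ 1 := by rw [div_le_one (by norm_num : (0:ℝ) < 4)]; exact he.le
    have hpow : (Real.exp 1 / 4) ^ (1 + (1 / Real.log M) / ρ ^ 2) ≤ Real.exp (-(c₁ * r)) := by
      rw [hq_eq]
      calc (Real.exp 1 / 4) ^ (1 + r / κ) ≤ (Real.exp 1 / 4) ^ (r / κ) :=
            Real.rpow_le_rpow_of_exponent_ge hbase0 hbase1 (by linarith)
        _ = Real.exp (-(c₁ * r)) := by
            rw [Real.rpow_def_of_pos hbase0, hc₁]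
            congr 1
            have : Real.log (Real.exp 1 / 4) = -Real.log (4 / Real.exp 1) := by
              rw [← Real.log_inv, inv_div]
            rw [this]
            field_simp
    -- count: `2^n/2 ≤ |A| ≤ |I^c| 2^n e^{-c₁√n}`
    have hA_le : (A.card : ℝ) ≤ Ic.card * (2 ^ n * Real.exp (-(c₁ * r))) := by
      calc (A.card : ℝ) ≤ (Ic.biUnion S).card := by exact_mod_cast card_le_card hA_sub
        _ ≤ ∑ l ∈ Ic, ((S l).card : ℝ) := by exact_mod_cast card_biUnion_le
        _ ≤ ∑ l ∈ Ic, 2 ^ n * (Real.exp 1 / 4) ^ (1 + (1 / Real.log M) / ρ ^ 2) :=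
            sum_le_sum fun l hl => hScard l hl
        _ ≤ ∑ l ∈ Ic, 2 ^ n * Real.exp (-(c₁ * r)) :=
            sum_le_sum fun l _ => mul_le_mul_of_nonneg_left hpow h2n.le
        _ = Ic.card * (2 ^ n * Real.exp (-(c₁ * r))) := by rw [sum_const, nsmul_eq_mul]
    have hIc_ge : Real.exp (c₁ * r) / 2 ≤ Ic.card := by
      have h1 : (2 : ℝ) ^ n / 2 ≤ Ic.card * (2 ^ n * Real.exp (-(c₁ * r))) := hA_half.trans hA_le
      have hEE : Real.exp (-(c₁ * r)) * Real.exp (c₁ * r) = 1 := by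
        rw [← Real.exp_add, neg_add_cancel, Real.exp_zero]
      have h2 : (2 : ℝ) ^ n / 2 * (Real.exp (c₁ * r) / 2 ^ n) ≤
          Ic.card * (2 ^ n * Real.exp (-(c₁ * r))) * (Real.exp (c₁ * r) / 2 ^ n) :=
        mul_le_mul_of_nonneg_right h1 (by positivity)
      have e1 : (2 : ℝ) ^ n / 2 * (Real.exp (c₁ * r) / 2 ^ n) = Real.exp (c₁ * r) / 2 := by
        field_simp
      have e2 : (Ic.card : ℝ) * (2 ^ n * Real.exp (-(c₁ * r))) * (Real.exp (c₁ * r) / 2 ^ n) =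
          Ic.card * (Real.exp (-(c₁ * r)) * Real.exp (c₁ * r)) := by
        field_simp
      rw [e1, e2, hEE, mul_one] at h2
      exact h2
    -- `e^{c√n} ≤ e^{c₁√n/2} ≤ e^{c₁√n}/2 ≤ |I^c| ≤ N`
    have hhalf : Real.exp (c * r) ≤ Real.exp (c₁ * r) / 2 := by
      have hcr : c * r ≤ c₁ / 2 * r := mul_le_mul_of_nonneg_right hcc₁ hr0.le
      have h1 : Real.exp (c * r) ≤ Real.exp (c₁ / 2 * r) := Real.exp_le_exp.2 hcr
      have h2 : 2 ≤ Real.exp (c₁ / 2 * r) := by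
        have h4 : 2 ≤ r * c₁ := (div_le_iff₀ hc₁pos).1 hc₁r
        have h5 : (1 : ℝ) ≤ c₁ / 2 * r := by
          have : c₁ / 2 * r = r * c₁ / 2 := by ring
          rw [this]; linarith
        have h3 : (2 : ℝ) ≤ c₁ / 2 * r + 1 := by linarith
        exact h3.trans (Real.add_one_le_exp _)
      have h3 : Real.exp (c₁ * r) = Real.exp (c₁ / 2 * r) * Real.exp (c₁ / 2 * r) := by
        rw [← Real.exp_add]; congr 1; ring
      rw [h3, le_div_iff₀ two_pos]
      calc Real.exp (c * r) * 2 ≤ Real.exp (c₁ / 2 * r) * 2 := mul_le_mul_of_nonneg_right h1 zero_le_two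
        _ ≤ Real.exp (c₁ / 2 * r) * Real.exp (c₁ / 2 * r) :=
            mul_le_mul_of_nonneg_left h2 (Real.exp_pos _).le
    exact hhalf.trans (hIc_ge.trans (hNcard Ic))

/-! ## The column-weighted kernel `(1-ε)(xᵀy)²/n + ε a(y)` (appended; for the elliptope, Remark 1)

For a general centre `A` and the ELLIPTOPE `E = {X ⪰ 0, X_ii = 1/n}` in place of `D` (Fawzi 2021, p. 4:
"Theorems 1 and 2 are also true (with the same proof) if we replace `D` with the (scaled) elliptope … This
is because the matrix we consider in Equation (3.3) is also a submatrix of the slack matrix of the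
elliptope", and Remark 1, p. 6, reducing a general `A` to `A = I/n` by sign and cyclic conjugations), the
hypercube slack submatrix computed in the STANDARD basis is `(1-ε)(xᵀy)²/n + ε a(y)` with the column
weight `a(y) = yᵀAy·n`, of mean `Tr A = 1` over the cube.  Instead of the printed Minkowski-averaging
reduction (which needs `xc(∑ Pᵢ) ≤ ∑ xc(Pᵢ)` for general slack-form EFs, absent from the tree) we prove
the §3 estimate directly for such column-weighted kernels: the printed argument goes through verbatim on
the columns with `a(y) < 3` (at least half of them, by Markov), with threshold `3 > e` in Lemma 1 and
`ρ² = 20/((1-ε)n)`.  DEVIATION recorded; the constants are again explicit.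
-/

/-- The **column-weighted hypercube kernel** `K_a(s,t) = (1-ε)(xᵀy)²/n + ε a(t)` (`a ≡ 1` is the kernel
(3.3); `a(t) = n y_tᵀ A y_t` is the elliptope/general-centre slack submatrix).
[cite: Fawzi2021, §3 eq. (3.3) (p. 6) and Remark 1 (p. 6)] -/
def quadKernelW (n : ℕ) (ε : ℝ) (a : (Fin n → Bool) → ℝ) (s t : Fin n → Bool) : ℝ :=
  (1 - ε) * ip s t ^ 2 / n + ε * a t

/-- Unfolding lemma. [cite: Fawzi2021, §3 eq. (3.3) (p. 6)] -/
theorem quadKernelW_apply (ε : ℝ) (a : (Fin n → Bool) → ℝ) (s t : Fin n → Bool) :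
    quadKernelW n ε a s t = (1 - ε) * ip s t ^ 2 / n + ε * a t := rfl

/-- With the constant weight `a ≡ 1` the weighted kernel is the kernel (3.3).
[cite: Fawzi2021, §3 eq. (3.3) (p. 6)] -/
theorem quadKernelW_one (ε : ℝ) : quadKernelW n ε (fun _ => (1 : ℝ)) = quadKernel n ε := by
  funext s t; rw [quadKernelW_apply, quadKernel_apply, mul_one]

/-- `K_a(s,t) ≤ (1-ε) n + ε a(t)` (`0 ≤ ε ≤ 1`, `n ≥ 1`). [cite: Fawzi2021, §3 (p. 7: "`‖f_i‖_∞ ‖g_i‖_∞ ≤ n`")] -/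
theorem quadKernelW_le {ε : ℝ} (hε1 : ε ≤ 1) (hn : 1 ≤ n) (a : (Fin n → Bool) → ℝ)
    (s t : Fin n → Bool) : quadKernelW n ε a s t ≤ (1 - ε) * n + ε * a t := by
  rw [quadKernelW_apply]
  have hn' : (1 : ℝ) ≤ n := by exact_mod_cast hn
  have hnpos : (0 : ℝ) < n := by linarith
  have h1 : ip s t ^ 2 / n ≤ n := by
    rw [div_le_iff₀ hnpos, ← sq]
    exact ip_sq_le s t
  have h2 : (1 - ε) * ip s t ^ 2 / n ≤ (1 - ε) * n := by
    rw [mul_div_assoc]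
    exact mul_le_mul_of_nonneg_left h1 (by linarith)
  linarith

/-- Column sums of the weighted kernel: `∑_s K_a(s,t) = 2^n ((1-ε) + ε a(t))` (`n ≥ 1`).
[cite: Fawzi2021, §3 (p. 6: "`E_x[(1-ε)(1/n)(xᵀy)² + ε] = 1`")] -/
theorem sum_quadKernelW (ε : ℝ) (a : (Fin n → Bool) → ℝ) (hn : 1 ≤ n) (t : Fin n → Bool) :
    ∑ s : Fin n → Bool, quadKernelW n ε a s t = 2 ^ n * ((1 - ε) + ε * a t) := by
  have hn0 : (n : ℝ) ≠ 0 := by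
    have : (1 : ℝ) ≤ n := by exact_mod_cast hn
    linarith
  simp_rw [quadKernelW_apply]
  rw [sum_add_distrib, sum_const, card_univ, Fintype.card_fun, Fintype.card_bool, Fintype.card_fin,
    nsmul_eq_mul]
  simp_rw [mul_div_assoc, ← mul_sum, ← sum_div]
  rw [sum_ip_sq]
  field_simp
  push_cast
  ring

/-- The noise operator on a column of the weighted kernel, on the diagonal:
`(T_ρ K_a(·,t))(t) = (1-ε)(1 + ρ²(n-1)) + ε a(t)` (`n ≥ 1`). [cite: Fawzi2021, §3 (p. 6)] -/
theorem noiseOperator_quadKernelW_self {ε ρ : ℝ} (a : (Fin n → Bool) → ℝ) (hn : 1 ≤ n) (t : Fin n → Bool) :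
    noiseOperator ρ (fun s => quadKernelW n ε a s t) t = (1 - ε) * (1 + ρ ^ 2 * (n - 1)) + ε * a t := by
  have hfun : (fun s => quadKernelW n ε a s t) =
      fun s => (fun s => quadKernel n ε s t) s + (fun _ => ε * a t - ε) s := by
    funext s; simp only [quadKernelW_apply, quadKernel_apply]; ring
  rw [hfun, noiseOperator_add, noiseOperator_const]
  simp only
  rw [noiseOperator_quadKernel_self hn]
  ring

/-- `n + 3 ≤ e^{√n/4}` once `n ≥ 6150` (from `x⁴/4! ≤ eˣ` at `x = √n/4`). [folklore] -/
private theorem nat_add_three_le_exp_sqrt_div_four (hn : 6150 ≤ n) :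
    (n : ℝ) + 3 ≤ Real.exp (Real.sqrt n / 4) := by
  have hn' : (6150 : ℝ) ≤ n := by exact_mod_cast hn
  have hsq : Real.sqrt (n : ℝ) ^ 2 = n := Real.sq_sqrt (Nat.cast_nonneg n)
  have h4 : (Real.sqrt n / 4) ^ 4 / (Nat.factorial 4) ≤ Real.exp (Real.sqrt n / 4) :=
    Real.pow_div_factorial_le_exp (x := Real.sqrt n / 4) (hx := by positivity) (n := 4)
  have hfac : (Nat.factorial 4 : ℝ) = 24 := by norm_num [Nat.factorial]
  rw [hfac] at h4
  have e : (Real.sqrt n / 4) ^ 4 / 24 = (n : ℝ) ^ 2 / 6144 := by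
    rw [div_pow, show (Real.sqrt (n : ℝ)) ^ 4 = (Real.sqrt n ^ 2) ^ 2 by ring, hsq]
    ring
  rw [e] at h4
  have hnn : (6150 : ℝ) * n ≤ n * n := mul_le_mul_of_nonneg_right hn' (by linarith)
  have h5 : (n : ℝ) + 3 ≤ (n : ℝ) ^ 2 / 6144 := by
    rw [le_div_iff₀ (by norm_num : (0 : ℝ) < 6144), sq]
    linarith
  exact h5.trans h4

set_option maxHeartbeats 800000 in
/-- **The §3 estimate for column-weighted kernels.**  For every `0 < ε < 1` there are `c > 0` and `n₀`
such that for all `n ≥ n₀` and every weight `a : {0,1}^n → ℝ` with `∑_t a(t) ≤ 2^n`: if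
`K_a(s,t) = (1-ε)(xᵀy)²/n + ε a(t)` is a sum of `N` nonnegative rank-one matrices then `e^{c√n} ≤ N`
(no sign hypothesis on `a` is needed: the column masses `m(t) = (1-ε) + ε a(t) = ∑_i g_i(t)` are
nonnegative because the factorization is).  The printed argument (Lemma 1, normalisation `E f_i = 1`,
spiked/flat split, Markov + union bound) run on the columns `t` with `m(t) < 2` (at least `2^n/2` of them,
by Markov), with `ρ² = 20/((1-ε)n)`, threshold `3`, `c = min(1/4, log(3/e)/(2κ))`, `κ = 20/(1-ε)`.
[cite: Fawzi2021, §3 (pp. 6–7) with Remark 1 (p. 6)] -/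
theorem quadKernelW_nonnegRank {ε : ℝ} (hε0 : 0 < ε) (hε1 : ε < 1) :
    ∃ c : ℝ, 0 < c ∧ ∃ n₀ : ℕ, ∀ n : ℕ, n₀ ≤ n → ∀ a : (Fin n → Bool) → ℝ,
      (∑ t, a t ≤ 2 ^ n) → ∀ N : ℕ,
      HasNonnegFactorization (quadKernelW n ε a) N → Real.exp (c * Real.sqrt n) ≤ N := by
  -- constants
  set κ : ℝ := 20 / (1 - ε) with hκ
  have h1ε : 0 < 1 - ε := by linarith
  have hκ20 : 20 ≤ κ := by
    rw [hκ, le_div_iff₀ h1ε]; nlinarith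
  have hκpos : 0 < κ := by linarith
  have he : Real.exp 1 < 3 := lt_trans Real.exp_one_lt_d9 (by norm_num)
  have h3e : 1 < 3 / Real.exp 1 := by rw [lt_div_iff₀ (Real.exp_pos 1)]; linarith
  set c₁ : ℝ := Real.log (3 / Real.exp 1) / κ with hc₁
  have hlog3e : 0 < Real.log (3 / Real.exp 1) := Real.log_pos h3e
  have hc₁pos : 0 < c₁ := div_pos hlog3e hκpos
  set c : ℝ := min (1 / 4) (c₁ / 2) with hc
  have hcpos : 0 < c := lt_min (by norm_num) (by linarith)
  have hc4 : c ≤ 1 / 4 := min_le_left _ _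
  have hcc₁ : c ≤ c₁ / 2 := min_le_right _ _
  refine ⟨c, hcpos, max 6150 (max ⌈κ ^ 2⌉₊ ⌈(6 / c₁) ^ 2⌉₊), fun n hn a hasum N hfac => ?_⟩
  -- unpacking `n ≥ n₀`
  have hn6150 : 6150 ≤ n := le_trans (le_max_left _ _) hn
  have hn6144 : 6144 ≤ n := le_trans (by norm_num) hn6150
  have hn1 : 1 ≤ n := le_trans (by norm_num) hn6144
  have hnR : (6150 : ℝ) ≤ n := by exact_mod_cast hn6150
  have hnpos : (0 : ℝ) < n := by linarith
  have hnκ : κ ^ 2 ≤ n := (Nat.le_ceil _).trans (by exact_mod_cast (le_max_left _ _).trans ((le_max_right _ _).trans hn))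
  have hnc₁ : (6 / c₁) ^ 2 ≤ n := (Nat.le_ceil _).trans (by exact_mod_cast (le_max_right _ _).trans ((le_max_right _ _).trans hn))
  set r : ℝ := Real.sqrt n with hr
  have hr0 : 0 < r := Real.sqrt_pos.2 hnpos
  have hrsq : r ^ 2 = n := Real.sq_sqrt hnpos.le
  have hrr : r * r = n := by rw [← sq, hrsq]
  have hκr : κ ≤ r := by
    rw [hr, ← Real.sqrt_sq hκpos.le]
    exact Real.sqrt_le_sqrt hnκ
  have hc₁r : 6 / c₁ ≤ r := by
    rw [hr, ← Real.sqrt_sq (div_pos (by norm_num) hc₁pos).le]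
    exact Real.sqrt_le_sqrt hnc₁
  have hr1 : 1 ≤ r := le_trans (by linarith) hκr
  -- `M = e^{√n}`, `ρ² = κ/n`, `q = 1 + √n/κ`
  set M : ℝ := Real.exp r with hM
  have hMpos : 0 < M := Real.exp_pos r
  have hlogM : Real.log M = r := Real.log_exp r
  set ρ : ℝ := Real.sqrt (κ / n) with hρ
  have hρpos : 0 < ρ := Real.sqrt_pos.2 (div_pos hκpos hnpos)
  have hρsq : ρ ^ 2 = κ / n := Real.sq_sqrt (div_pos hκpos hnpos).le
  have hκsq : κ ≤ κ ^ 2 := by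
    rw [sq]; exact le_mul_of_one_le_right hκpos.le (by linarith)
  have hκn : κ ≤ n := hκsq.trans hnκ
  have hρ1 : ρ ≤ 1 := by
    rw [hρ, Real.sqrt_le_one]
    exact (div_le_one hnpos).2 hκn
  have hq_eq : 1 + (1 / Real.log M) / ρ ^ 2 = 1 + r / κ := by
    rw [hlogM, hρsq, ← hrr]
    field_simp
  have hq2 : 2 ≤ 1 + (1 / Real.log M) / ρ ^ 2 := by
    rw [hq_eq]
    have : 1 ≤ r / κ := by rw [le_div_iff₀ hκpos, one_mul]; exact hκr
    linarith
  -- normalise the factorization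
  obtain ⟨F, G, hF0, hG0, hFmean, hFG⟩ := exists_normalized hfac
  have h2n : (0 : ℝ) < 2 ^ n := by positivity
  -- `∑_l G_l(t) = m(t) := (1-ε) + ε a(t)`
  have hGsum : ∀ t, ∑ l, G l t = (1 - ε) + ε * a t := by
    intro t
    have h1 : ∑ s, quadKernelW n ε a s t = ∑ l, (∑ s, F l s) * G l t := by
      simp_rw [hFG, sum_mul]
      rw [sum_comm]
    rw [sum_quadKernelW ε a hn1 t] at h1
    have h2 : ∑ l, (∑ s, F l s) * G l t = 2 ^ n * ∑ l, G l t := by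
      rw [mul_sum]
      refine sum_congr rfl fun l _ => ?_
      have := hFmean l
      rw [div_eq_iff h2n.ne'] at this
      rw [this]; ring
    rw [h2] at h1
    exact (mul_left_cancel₀ h2n.ne' h1).symm
  -- `F_l(s) G_l(t) ≤ K_a(s,t) ≤ (1-ε) n + ε a(t)`
  have hFGle : ∀ l s t, F l s * G l t ≤ (1 - ε) * n + ε * a t := by
    intro l s t
    calc F l s * G l t ≤ ∑ l', F l' s * G l' t :=
          single_le_sum (f := fun l' => F l' s * G l' t) (fun l' _ => mul_nonneg (hF0 l' s) (hG0 l' t))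
            (mem_univ l)
      _ = quadKernelW n ε a s t := (hFG s t).symm
      _ ≤ (1 - ε) * n + ε * a t := quadKernelW_le hε1.le hn1 a s t
  -- Step 1: apply `T_ρ` in `s` and evaluate on the diagonal
  have hdiag : ∀ t, ∑ l, G l t * noiseOperator ρ (F l) t = (1 - ε) * (1 + ρ ^ 2 * (n - 1)) + ε * a t := by
    intro t
    have hfun : (fun s => quadKernelW n ε a s t) = fun s => ∑ l, G l t * F l s := by
      funext s; rw [hFG s t]; exact sum_congr rfl fun l _ => mul_comm _ _
    have h1 := noiseOperator_quadKernelW_self (ε := ε) (ρ := ρ) a hn1 t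
    rw [hfun, noiseOperator_finset_sum] at h1
    rw [← h1]
    refine sum_congr rfl fun l _ => ?_
    rw [noiseOperator_smul]
  have hbulk : 10 ≤ (1 - ε) * (ρ ^ 2 * (n - 1)) := by
    have e1 : (1 - ε) * (ρ ^ 2 * (n - 1)) = 20 * (n - 1) / n := by
      rw [hρsq, hκ]; field_simp
    rw [e1, le_div_iff₀ hnpos]; linarith
  -- the index set `I` of spiked functions and its complement
  set I : Finset (Fin N) := univ.filter fun l => ∃ s, M ≤ F l s with hI
  set Ic : Finset (Fin N) := univ.filter fun l => ¬ ∃ s, M ≤ F l s with hIc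
  have hGsmall : ∀ l ∈ I, ∀ t, (1 - ε) + ε * a t < 2 → G l t ≤ (n + 3) / M := by
    intro l hl t hmt
    obtain ⟨s, hs⟩ := (mem_filter.1 hl).2
    rw [le_div_iff₀ hMpos]
    calc G l t * M ≤ G l t * F l s := mul_le_mul_of_nonneg_left hs (hG0 l t)
      _ = F l s * G l t := mul_comm _ _
      _ ≤ (1 - ε) * n + ε * a t := hFGle l s t
      _ ≤ n + 3 := by
          have h1 : (1 - ε) * (n : ℝ) ≤ n := by
            have := mul_le_mul_of_nonneg_right (show (1 - ε) ≤ 1 by linarith) hnpos.le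
            linarith
          linarith
  have hFflat : ∀ l ∈ Ic, ∀ s, F l s ≤ M := by
    intro l hl s
    have h := (mem_filter.1 hl).2
    by_contra h'
    exact h ⟨s, (not_le.1 h').le⟩
  have hTF0 : ∀ l t, 0 ≤ noiseOperator ρ (F l) t := fun l t => noiseOperator_nonneg hρpos.le hρ1 (hF0 l) t
  have hTFsum : ∀ l, ∑ t, noiseOperator ρ (F l) t = 2 ^ n := by
    intro l
    rw [sum_noiseOperator]
    have := hFmean l
    rwa [div_eq_iff h2n.ne', one_mul] at this
  have hNcard : ∀ S : Finset (Fin N), (S.card : ℝ) ≤ N := fun S => by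
    exact_mod_cast (card_le_univ S).trans_eq (Fintype.card_fin N)
  -- the column masses `m(t) = (1-ε) + ε a(t) = ∑_l G_l(t) ≥ 0` have total `≤ 2^n`; Markov:
  -- at most `2^n/2` columns have `m(t) ≥ 2`
  have hm0 : ∀ t, 0 ≤ (1 - ε) + ε * a t := fun t => by
    rw [← hGsum t]; exact sum_nonneg fun l _ => hG0 l t
  have hT_card : ((univ.filter fun t : Fin n → Bool => (2 : ℝ) ≤ (1 - ε) + ε * a t).card : ℝ) ≤ 2 ^ n / 2 := by
    have h1 := card_filter_mul_le_sum (fun t => (1 - ε) + ε * a t) hm0 2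
    have h2 : ∑ t : Fin n → Bool, ((1 - ε) + ε * a t) ≤ 2 ^ n := by
      rw [sum_add_distrib, sum_const, card_univ, Fintype.card_fun, Fintype.card_bool, Fintype.card_fin,
        nsmul_eq_mul, ← mul_sum]
      push_cast
      nlinarith [hasum, hε0.le]
    linarith
  -- final target: `e^{c√n} ≤ N`; two cases on `|I|`
  by_cases hIbig : Real.exp (r / 4) ≤ I.card
  · -- Case `|I| ≥ e^{√n/4}`
    have hcr : c * r ≤ r / 4 := (mul_le_mul_of_nonneg_right hc4 hr0.le).trans_eq (by ring)
    calc Real.exp (c * r) ≤ Real.exp (r / 4) := Real.exp_le_exp.2 hcr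
      _ ≤ I.card := hIbig
      _ ≤ N := hNcard I
  · push Not at hIbig
    -- Markov: `#{t : T_ρ F_l(t) ≥ e^{√n/2}} ≤ 2^n e^{-√n/2}`
    set B : Fin N → Finset (Fin n → Bool) :=
      fun l => univ.filter fun t => Real.exp (r / 2) ≤ noiseOperator ρ (F l) t with hB
    have hBcard : ∀ l, ((B l).card : ℝ) ≤ 2 ^ n / Real.exp (r / 2) := by
      intro l
      rw [le_div_iff₀ (Real.exp_pos _)]
      have := card_filter_mul_le_sum (noiseOperator ρ (F l)) (hTF0 l) (Real.exp (r / 2))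
      rw [hTFsum l] at this
      exact this
    -- the good set `A` (light columns on which no spiked function is large) and its complement
    set A : Finset (Fin n → Bool) :=
      univ.filter fun t => (1 - ε) + ε * a t < 2 ∧ ∀ l ∈ I, noiseOperator ρ (F l) t < Real.exp (r / 2) with hA
    set Ac : Finset (Fin n → Bool) :=
      univ.filter fun t => ¬ ((1 - ε) + ε * a t < 2 ∧ ∀ l ∈ I, noiseOperator ρ (F l) t < Real.exp (r / 2))
      with hAc
    have hAAc : (A.card : ℝ) + Ac.card = 2 ^ n := by
      have h := card_filter_add_card_filter_not
        (s := (univ : Finset (Fin n → Bool)))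
        (fun t => (1 - ε) + ε * a t < 2 ∧ ∀ l ∈ I, noiseOperator ρ (F l) t < Real.exp (r / 2))
      rw [card_univ, Fintype.card_fun, Fintype.card_bool, Fintype.card_fin] at h
      exact_mod_cast h
    have hAc_sub : Ac ⊆ (univ.filter fun t : Fin n → Bool => (2 : ℝ) ≤ (1 - ε) + ε * a t) ∪ I.biUnion B := by
      intro t ht
      rw [hAc, mem_filter] at ht
      rw [mem_union]
      by_cases hat : (1 - ε) + ε * a t < 2
      · right
        obtain ⟨l, hlI, hl⟩ : ∃ l ∈ I, ¬ noiseOperator ρ (F l) t < Real.exp (r / 2) := by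
          by_contra h
          push Not at h
          exact ht.2 ⟨hat, fun l hl => h l hl⟩
        exact mem_biUnion.2 ⟨l, hlI, mem_filter.2 ⟨mem_univ t, not_lt.1 hl⟩⟩
      · left
        exact mem_filter.2 ⟨mem_univ t, not_lt.1 hat⟩
    have hAc_card : (Ac.card : ℝ) ≤ 2 ^ n / 2 + I.card * (2 ^ n / Real.exp (r / 2)) := by
      calc (Ac.card : ℝ)
          ≤ (((univ.filter fun t : Fin n → Bool => (2 : ℝ) ≤ (1 - ε) + ε * a t) ∪ I.biUnion B).card : ℝ) := by
            exact_mod_cast card_le_card hAc_sub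
        _ ≤ ((univ.filter fun t : Fin n → Bool => (2 : ℝ) ≤ (1 - ε) + ε * a t).card : ℝ) +
              ((I.biUnion B).card : ℝ) := by
            exact_mod_cast card_union_le _ _
        _ ≤ 2 ^ n / 2 + ∑ l ∈ I, ((B l).card : ℝ) := by
            have := hT_card
            have h2 : ((I.biUnion B).card : ℝ) ≤ ∑ l ∈ I, ((B l).card : ℝ) := by exact_mod_cast card_biUnion_le
            linarith
        _ ≤ 2 ^ n / 2 + ∑ l ∈ I, 2 ^ n / Real.exp (r / 2) := by
            have := sum_le_sum fun l (_ : l ∈ I) => hBcard l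
            linarith
        _ = 2 ^ n / 2 + I.card * (2 ^ n / Real.exp (r / 2)) := by rw [sum_const, nsmul_eq_mul]
    -- `|I| 2^n e^{-√n/2} ≤ 2^n e^{-√n/4} ≤ 2^n / 4`
    have hexp_split : Real.exp (r / 2) = Real.exp (r / 4) * Real.exp (r / 4) := by
      rw [← Real.exp_add]; congr 1; ring
    have hexp4 : 4 ≤ Real.exp (r / 4) := by
      have h1 : (4 : ℝ) ≤ r / 4 + 1 := by linarith
      exact h1.trans (Real.add_one_le_exp _)
    have hAc_bound : (Ac.card : ℝ) ≤ 2 ^ n / 2 + 2 ^ n / 4 := by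
      have h1 : (I.card : ℝ) * (2 ^ n / Real.exp (r / 2)) ≤ Real.exp (r / 4) * (2 ^ n / Real.exp (r / 2)) :=
        mul_le_mul_of_nonneg_right hIbig.le (by positivity)
      have h2 : Real.exp (r / 4) * (2 ^ n / Real.exp (r / 2)) = 2 ^ n / Real.exp (r / 4) := by
        rw [hexp_split]; field_simp
      have h3 : (2 : ℝ) ^ n / Real.exp (r / 4) ≤ 2 ^ n / 4 :=
        div_le_div_of_nonneg_left h2n.le (by norm_num) hexp4
      linarith [hAc_card]
    have hA_quarter : (2 : ℝ) ^ n / 4 ≤ A.card := by linarith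
    -- on `A`, some `l ∉ I` has `T_ρ F_l(t) ≥ 3`
    set S : Fin N → Finset (Fin n → Bool) :=
      fun l => univ.filter fun t => (3 : ℝ) ≤ noiseOperator ρ (F l) t with hS
    have hnexp : (n : ℝ) + 3 ≤ Real.exp (r / 4) := nat_add_three_le_exp_sqrt_div_four hn6150
    have hA_sub : A ⊆ Ic.biUnion S := by
      intro t ht
      rw [hA, mem_filter] at ht
      have hmt : (1 - ε) + ε * a t < 2 := ht.2.1
      -- the `I`-part of the diagonal sum is `≤ 1`
      have hIpart : ∑ l ∈ I, G l t * noiseOperator ρ (F l) t ≤ 1 := by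
        calc ∑ l ∈ I, G l t * noiseOperator ρ (F l) t
            ≤ ∑ l ∈ I, (n + 3) / M * Real.exp (r / 2) := sum_le_sum fun l hl =>
              mul_le_mul (hGsmall l hl t hmt) (ht.2.2 l hl).le (hTF0 l t) (by positivity)
          _ = I.card * ((n + 3) / M * Real.exp (r / 2)) := by rw [sum_const, nsmul_eq_mul]
          _ ≤ Real.exp (r / 4) * ((n + 3) / M * Real.exp (r / 2)) :=
              mul_le_mul_of_nonneg_right hIbig.le (by positivity)
          _ = (n + 3) / Real.exp (r / 4) := by
              rw [hM, hexp_split, show Real.exp r = Real.exp (r / 4) * Real.exp (r / 4) *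
                (Real.exp (r / 4) * Real.exp (r / 4)) by rw [← Real.exp_add, ← Real.exp_add]; congr 1; ring]
              field_simp
          _ ≤ 1 := by rw [div_le_one (Real.exp_pos _)]; exact hnexp
      -- hence the `I^c`-part is `≥ m(t) + 9`
      have hsplit : ∑ l ∈ I, G l t * noiseOperator ρ (F l) t + ∑ l ∈ Ic, G l t * noiseOperator ρ (F l) t =
          (1 - ε) * (1 + ρ ^ 2 * (n - 1)) + ε * a t := by
        rw [hI, hIc, sum_filter_add_sum_filter_not]
        exact hdiag t
      have hIcpart : (1 - ε) + ε * a t + 9 ≤ ∑ l ∈ Ic, G l t * noiseOperator ρ (F l) t := by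
        have e : (1 - ε) * (1 + ρ ^ 2 * (n - 1)) + ε * a t = (1 - ε) + ε * a t + (1 - ε) * (ρ ^ 2 * (n - 1)) := by
          ring
        linarith
      -- if every `l ∉ I` had `T_ρ F_l(t) < 3` the `I^c`-part would be `≤ 3 ∑ G = 3 m(t) < m(t) + 9`
      by_contra hnot
      have hall : ∀ l ∈ Ic, noiseOperator ρ (F l) t < 3 := by
        intro l hl
        by_contra h
        exact hnot (mem_biUnion.2 ⟨l, hl, mem_filter.2 ⟨mem_univ t, not_lt.1 h⟩⟩)
      have h1 : ∑ l ∈ Ic, G l t * noiseOperator ρ (F l) t ≤ ∑ l ∈ Ic, G l t * 3 :=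
        sum_le_sum fun l hl => mul_le_mul_of_nonneg_left (hall l hl).le (hG0 l t)
      have h2 : ∑ l ∈ Ic, G l t * 3 ≤ 3 * ((1 - ε) + ε * a t) := by
        calc ∑ l ∈ Ic, G l t * 3 ≤ ∑ l, G l t * 3 :=
              sum_le_sum_of_subset_of_nonneg (filter_subset _ _) fun l _ _ => mul_nonneg (hG0 l t) (by norm_num)
          _ = 3 * ((1 - ε) + ε * a t) := by rw [← sum_mul, hGsum t, mul_comm]
      linarith
    -- Lemma 1 for the flat functions `l ∉ I`, threshold `3`
    have hScard : ∀ l ∈ Ic, ((S l).card : ℝ) ≤ 2 ^ n * (Real.exp 1 / 3) ^ (1 + (1 / Real.log M) / ρ ^ 2) := by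
      intro l hl
      exact card_noiseOperator_ge_le (by rw [hlogM]; exact hr1) hρpos hq2 (by norm_num) (hF0 l)
        (hFflat l hl) (hFmean l)
    -- `(e/3)^q ≤ e^{-c₁ √n}`
    have hbase0 : 0 < Real.exp 1 / 3 := by positivity
    have hbase1 : Real.exp 1 / 3 ≤ 1 := by rw [div_le_one (by norm_num : (0:ℝ) < 3)]; exact he.le
    have hpow : (Real.exp 1 / 3) ^ (1 + (1 / Real.log M) / ρ ^ 2) ≤ Real.exp (-(c₁ * r)) := by
      rw [hq_eq]
      calc (Real.exp 1 / 3) ^ (1 + r / κ) ≤ (Real.exp 1 / 3) ^ (r / κ) :=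
            Real.rpow_le_rpow_of_exponent_ge hbase0 hbase1 (by linarith)
        _ = Real.exp (-(c₁ * r)) := by
            rw [Real.rpow_def_of_pos hbase0, hc₁]
            congr 1
            have : Real.log (Real.exp 1 / 3) = -Real.log (3 / Real.exp 1) := by
              rw [← Real.log_inv, inv_div]
            rw [this]
            field_simp
    -- count: `2^n/4 ≤ |A| ≤ |I^c| 2^n e^{-c₁√n}`
    have hA_le : (A.card : ℝ) ≤ Ic.card * (2 ^ n * Real.exp (-(c₁ * r))) := by
      calc (A.card : ℝ) ≤ (Ic.biUnion S).card := by exact_mod_cast card_le_card hA_sub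
        _ ≤ ∑ l ∈ Ic, ((S l).card : ℝ) := by exact_mod_cast card_biUnion_le
        _ ≤ ∑ l ∈ Ic, 2 ^ n * (Real.exp 1 / 3) ^ (1 + (1 / Real.log M) / ρ ^ 2) :=
            sum_le_sum fun l hl => hScard l hl
        _ ≤ ∑ l ∈ Ic, 2 ^ n * Real.exp (-(c₁ * r)) :=
            sum_le_sum fun l _ => mul_le_mul_of_nonneg_left hpow h2n.le
        _ = Ic.card * (2 ^ n * Real.exp (-(c₁ * r))) := by rw [sum_const, nsmul_eq_mul]
    have hIc_ge : Real.exp (c₁ * r) / 4 ≤ Ic.card := by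
      have h1 : (2 : ℝ) ^ n / 4 ≤ Ic.card * (2 ^ n * Real.exp (-(c₁ * r))) := hA_quarter.trans hA_le
      have hEE : Real.exp (-(c₁ * r)) * Real.exp (c₁ * r) = 1 := by
        rw [← Real.exp_add, neg_add_cancel, Real.exp_zero]
      have h2 : (2 : ℝ) ^ n / 4 * (Real.exp (c₁ * r) / 2 ^ n) ≤
          Ic.card * (2 ^ n * Real.exp (-(c₁ * r))) * (Real.exp (c₁ * r) / 2 ^ n) :=
        mul_le_mul_of_nonneg_right h1 (by positivity)
      have e1 : (2 : ℝ) ^ n / 4 * (Real.exp (c₁ * r) / 2 ^ n) = Real.exp (c₁ * r) / 4 := by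
        field_simp
      have e2 : (Ic.card : ℝ) * (2 ^ n * Real.exp (-(c₁ * r))) * (Real.exp (c₁ * r) / 2 ^ n) =
          Ic.card * (Real.exp (-(c₁ * r)) * Real.exp (c₁ * r)) := by
        field_simp
      rw [e1, e2, hEE, mul_one] at h2
      exact h2
    -- `e^{c√n} ≤ e^{c₁√n/2} ≤ e^{c₁√n}/4 ≤ |I^c| ≤ N`
    have hquarter : Real.exp (c * r) ≤ Real.exp (c₁ * r) / 4 := by
      have hcr : c * r ≤ c₁ / 2 * r := mul_le_mul_of_nonneg_right hcc₁ hr0.le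
      have h1 : Real.exp (c * r) ≤ Real.exp (c₁ / 2 * r) := Real.exp_le_exp.2 hcr
      have h2 : 4 ≤ Real.exp (c₁ / 2 * r) := by
        have h4 : 6 ≤ r * c₁ := (div_le_iff₀ hc₁pos).1 hc₁r
        have h5 : (3 : ℝ) ≤ c₁ / 2 * r := by
          have : c₁ / 2 * r = r * c₁ / 2 := by ring
          rw [this]; linarith
        have h3 : (4 : ℝ) ≤ c₁ / 2 * r + 1 := by linarith
        exact h3.trans (Real.add_one_le_exp _)
      have h3 : Real.exp (c₁ * r) = Real.exp (c₁ / 2 * r) * Real.exp (c₁ / 2 * r) := by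
        rw [← Real.exp_add]; congr 1; ring
      rw [h3, le_div_iff₀ (by norm_num : (0 : ℝ) < 4)]
      calc Real.exp (c * r) * 4 ≤ Real.exp (c₁ / 2 * r) * 4 := mul_le_mul_of_nonneg_right h1 (by norm_num)
        _ ≤ Real.exp (c₁ / 2 * r) * Real.exp (c₁ / 2 * r) :=
            mul_le_mul_of_nonneg_left h2 (Real.exp_pos _).le
    exact hquarter.trans (hIc_ge.trans (hNcard Ic))

end Fawzi2021

end Literature.Combinatorics.Optimization

end
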